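import Mathlib.Analysis.InnerProductSpace.Harmonic.Basic
import Mathlib.Analysis.SpecialFunctions.Pow.Asymptotics
import Literature.Geometry.Lorentzian.AsymptoticFlatness
import HarnessLib

/-!
# Harmonically flat ends and Bray's total mass (family `gr`, proof architecture of **gr.S09**
# `riemannian_penrose_inequality`; namespace `Literature.Geometry.Lorentzian`)

Bray, J. Differential Geom. 59 (2001) 177–267 (arXiv:math/9911173, same numbering), proves the
Riemannian Penrose inequality first for manifolds which are *harmonically flat at infinity*
(§2, Def. 1; §3, "Assumption": the conformal flow of metrics, Thms. 2–4, is run on complete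
harmonically flat manifolds) and passes to asymptotically flat ones in §13 by the density
Lemma 1 (Schoen–Yau) and the closedness of the inequality ((226)). This file vendors the §2
notions for one end `e : AFEnd X` read in its chart (open-end design of
`AsymptoticFlatness.lean`), with real definitions and proved well-definedness, and two printed
ingredients as named facts (D-0014; nothing is asserted; both are discharged in the companion
files `HarmonicallyFlatProofs.lean` and `HarmonicallyFlatADMProofs.lean`), while Lemma 1 itself
is deliberately **not** vendored (see "What is not vendored" below):

* `HasHarmonicExpansion U a b` — the expansion (10), `U(x) = a + b/|x| + O(1/|x|²)` at
  infinity, with `HasHarmonicExpansion.tendsto` (`U → a`), `.congr`, and `.unique` (the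
  coefficients are determined by the germ of `U` at infinity), proved;
* `AFEnd.IsHarmonicallyFlatWith e D R₁ U`, `AFEnd.IsHarmonicallyFlat e D` — Def. 1 for the end
  `e` beyond the chart radius `R₁`: `h_ij = U⁴ δ_ij` with `U > 0` harmonic, zero scalar
  curvature, `U → a > 0`; API `le_radius`, `pos`, `hCoeff_eq`, `scalarCurvatureCoeff_eq_zero`,
  `harmonicOnNhd`, `exists_tendsto`, `mono`, and `factor_eq` / `factor_eventuallyEq` (the
  conformal factor is determined by the metric), proved;
* `AFEnd.HasHarmonicallyFlatMass e D m` — Def. 2, `m = 2ab`, with `.unique` (well defined),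
  proved;
* `Bray2001_harmonicFactor_expansion` — named fact: a harmonic function on an exterior region of
  `ℝ³` tending to a constant has the expansion (10) (Bray's sentence before (10); Folland,
  Prop. 2.74 and the expansion in the proof of Prop. 2.75); consequence
  `AFEnd.IsHarmonicallyFlat.exists_hasHarmonicallyFlatMass`
  (every harmonically flat end has a total mass), proved from it;
* `Bray2001_harmonicallyFlatMass_hasADMEnergy` — named fact: Def. 2 agrees with the ADM flux
  limit (225) in the asymptotically flat chart (conformal factor tending to `1`);
* Lemma 1 (Schoen–Yau density: asymptotically flat metrics with `R ≥ 0` are approximated,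
  uniformly ((7)) and in total mass ((8)), by harmonically flat ones with `R ≥ 0`) — **not
  vendored**; its printed statement, its sources and its reviewed one-end reading in this file's
  vocabulary are recorded in "What is not vendored" below.

The conformal flow (Thms. 2–4, 18) and §13 are the subject of other files; the reduction of the
corrected gr.S09 statement `riemannian_penrose_inequality_smooth` is `OutermostHorizonSmooth.lean`.

## Mathlib and design

Mathlib has harmonic functions on finite-dimensional inner product spaces
(`InnerProductSpace.HarmonicOnNhd`) but no Kelvin transform, expansion at infinity or
spherical harmonics, hence (10) is a named fact. The tree's `AFEnd.HasHarmonicAsymptotics`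
(`HarmonicAsymptotics.lean`, Eichmair–Huang–Lee–Schoen, Def. 4: `u → 1` with a weighted-Hölder
remainder, `u` *not* harmonic, plus a momentum clause) is a different notion, not used here.
*One end, fixed chart:* Def. 1 speaks of all ends of `M`; the predicates concern the end `e` in
its given chart beyond an enlargeable radius `R₁ ≥ e.R` ("outside a compact set"; the junk
values of `hCoeff`, `scalarCurvatureCoeff` inside the ball `‖x‖ ≤ e.R` are never met).
*Harmonicity and zero scalar curvature are both recorded:* Def. 1 asks for zero scalar
curvature on the end, and Bray immediately infers (App. A, `R(u⁴ δ) = -8 u⁻⁵ Δu`) that the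
factor is harmonic, which is what (10) and Def. 2 use; `IsHarmonicallyFlatWith` records both
clauses (the transformation law is not in the tree), so facts assuming it are weaker (no
declaration of this file concludes it). *Sign and limit of the factor:* in the chart of an
asymptotically flat end `h → δ` forces `a = 1`, under which the ADM comparison fact is stated
(`2a³b` versus `2ab`, see its docstring); Def. 1 itself allows any positive limit `a`, and so does
`IsHarmonicallyFlatWith`. *Expansion as a plain `O`-statement* along `Bornology.cobounded E3`,
without derivative control (for harmonic `U` it follows; the facts needing it assume harmonicity).

## What is not vendored: Lemma 1 (Schoen–Yau density)

Bray's Lemma 1 (§2, arXiv p. 5), verbatim: *"(Schoen, Yau [SY5]) Let `(M³, g)` be any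
asymptotically flat metric with nonnegative scalar curvature. Then given any `ε > 0`, there exists
a metric `g₀` with nonnegative scalar curvature which is harmonically flat at infinity (defined
in the next definition) such that (7) `1 - ε ≤ g₀(v, v)/g(v, v) ≤ 1 + ε` for all nonzero
vectors `v` in the tangent space at every point in `M` and (8) `|m̄ₖ - mₖ| ≤ ε` where `m̄ₖ` and
`mₖ` are respectively the total masses of `(M³, g₀)` and `(M³, g)` in the `k`th end"* —
"asymptotically flat" being Def. 21 (§13: `g_ij = δ_ij + O(|x|^{-p})`,
`|x||g_ij,k| + |x|²|g_ij,kl| = O(|x|^{-p})`, `|R(g)| = O(|x|^{-q})`, `p > 1/2`, `q > 3`), `m̄ₖ`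
the mass `2ab` of Def. 2 and `mₖ` the flux limit (225). It is a published theorem (Bray's
[SY5] = Schoen–Yau 1981; the construction — cut-off `⁽σ⁾g = ψ_σ g + (1 - ψ_σ) δ` in the given
chart, then the conformal correction `u_σ → 1` solving `L_σ u_σ = 0`, with
`|E(⁽σ⁾ḡ) - E(g)| < ε` — is printed by Schoen, LNM 1365 (1989), §4, Prop. 4.1 and the note after
its proof, pp. 144–145, where the existence of `u_σ` is referred to Bartnik's weighted elliptic
theory), and it is **not** stated in this file, for two reasons. (i) Its proof is an analytic
theory absent from Mathlib and from the tree — existence, positivity and decay of solutions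
`u → 1` of `Δ_g u = f u` on a complete asymptotically flat `3`-manifold (weighted Sobolev/Hölder
Fredholm theory, maximum principle), the conformal transformation law of
`PseudoRiemannianMetric.scalarCurvature`, the cut-off metric as a new `InitialDataSet`, and
continuity of the ADM mass (225) under the cut-off for `p > 1/2`, `q > 3` (the tree's Bartnik
facts `AFEnd.HasADMEnergy_of_isAsymptoticallyFlat`, `AFEnd.HasADMEnergy.Of_isSameEnd` are
themselves named facts) — so that a discharge is out of reach and no honest split into a few
`M`-sized published results exists (D-0026). (ii) Nothing in the tree consumes it: the analytic
content of Bray's proof, Lemma 1 included, sits inside the named fact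
`Bray2001_penrose_inequality_exteriorRegion` (`OutermostHorizon.lean`), and, as for the existence
statement of Thms. 2–4 in `ConformalFlow.lean`, an assembly of the §13 step would take the
perturbation as an explicit hypothesis beside `HasConformalFlowHF` (unproved literature facts
enter the tree only on request). *History:* vendored 2026-08-14 as
`Bray2001_harmonicallyFlat_approximation` (first in a same-chart, factor-`→ 1` form printed by
neither source, then, 2026-08-15, in Bray's chart-free form) and withdrawn 2026-08-15 after two
prove-seat triages "XL"; no declaration ever used it. *Reviewed one-end reading, for a vendoring
on request* (notions of `AsymptoticFlatness.lean` and of this file): for time-symmetric data `D`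
on a connected Hausdorff second-countable `X` with `0 ≤ R(h)` everywhere, an end `e` with
`e.IsMetricAsymptoticallyFlat D p` for some `p > 1/2` and `e.scalarCurvatureCoeff D = O(‖x‖^{-q})`
along `Bornology.cobounded E3` for some `q > 3`, `e.IsSoleEnd`, `D.IsComplete` and
`∃ m, e.HasADMEnergy D m`: for every `ε > 0` there are time-symmetric complete data `D'` on `X`
(with Levi-Civita connection) with `0 ≤ R` everywhere,
`1 - ε ≤ D'.metric.val x v v / D.metric.val x v v ≤ 1 + ε` for all `x` and all `v ≠ 0`, and an
end structure `e'` with `AFEnd.IsSameEnd e e'`, `e'.HasHarmonicallyFlatMass D' m'` and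
`|m' - e.admEnergy D| ≤ ε` — harmonic flatness in *some* conformal chart of the end with factor
`→ a > 0`, as Def. 1 prints it (one end instead of several and completeness as a hypothesis only
weaken it; completeness of `D'`, which the Assumption of §3 needs, follows from (7)).

## References

* H. L. Bray, *Proof of the Riemannian Penrose inequality using the positive mass theorem*,
  J. Differential Geom. 59 (2001) 177–267 (arXiv:math/9911173): §2, Lemma 1 with (7)–(8),
  Def. 1, (9), (10), Def. 2; §3 (Assumption); §13, Def. 21, (225), (226); App. A (conformal
  transformation of scalar curvature).
* G. B. Folland, *Introduction to Partial Differential Equations*, 2nd ed., Princeton, §2.I: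
  Thm. 2.73 (Kelvin transform), Prop. 2.74, Prop. 2.75 and (2.76) (`u = ∑ |x|^{2-n-k} Yₖ`).
* R. Schoen, S.-T. Yau, *Proof of the positive mass theorem. II*, Comm. Math. Phys. 79 (1981)
  231–260 (Bray's [SY5] for Lemma 1; its p. 234 refers the weakened asymptotic conditions to
  Schoen–Yau, *The energy and the linear momentum of space-times in general relativity*,
  Comm. Math. Phys. 79 (1981) 47–51).
* R. Schoen, *Variational theory for the total scalar curvature functional for Riemannian
  metrics and related topics*, Lecture Notes in Math. 1365 (1989) 120–154, §4, pp. 143–145: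
  the asymptotic conditions `p > (n-2)/2`, `q > n`, Prop. 4.1 and the note following its proof
  (the same-chart construction behind Lemma 1; see "What is not vendored").
-/

noncomputable section

open Bundle Set Manifold TopologicalSpace Filter Asymptotics Bornology
open scoped ContDiff Topology Manifold Real

namespace Literature.Geometry.Lorentzian

/-! ### Harmonic functions with an expansion `a + b/|x|` at infinity -/

/-- **Bray's expansion (10)** of the conformal factor of a harmonically flat end: the function
`U : ℝ³ → ℝ` satisfies `U(x) = a + b/|x| + O(1/|x|²)` as `|x| → ∞` (along
`Bornology.cobounded`; Bray, J. Differential Geom. 59 (2001), §2, (10): *"since `𝒰₀(x)` is a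
harmonic function going to a constant at infinity, we may expand it in terms of spherical
harmonics to get `𝒰₀(x) = a + b/|x| + O(1/|x|²)`"*). Only the expansion is recorded (no
harmonicity), so that the predicate is a plain asymptotic statement.
[cite: BrayRPI2001, §2 (10)] -/
def HasHarmonicExpansion (U : E3 → ℝ) (a b : ℝ) : Prop :=
  (fun x ↦ U x - (a + b * ‖x‖⁻¹)) =O[cobounded E3] fun x ↦ ‖x‖ ^ (-2 : ℝ)

namespace HasHarmonicExpansion

/-- `1/|x| → 0` at infinity in `ℝ³`. [folklore] -/
lemma tendsto_inv_norm_cobounded : Tendsto (fun x : E3 ↦ ‖x‖⁻¹) (cobounded E3) (𝓝 0) :=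
  tendsto_norm_cobounded_atTop.inv_tendsto_atTop
/-- `|x|⁻² → 0` at infinity in `ℝ³`. [folklore] -/
lemma tendsto_norm_rpow_neg_two_cobounded :
    Tendsto (fun x : E3 ↦ ‖x‖ ^ (-2 : ℝ)) (cobounded E3) (𝓝 0) :=
  (tendsto_rpow_neg_atTop (by norm_num : (0 : ℝ) < 2)).comp tendsto_norm_cobounded_atTop
/-- A function with the expansion `a + b/|x| + O(|x|⁻²)` tends to `a` at infinity. Bray 2001,
§2, (10) ("going to a constant at infinity"). [cite: BrayRPI2001, §2 (10)] -/
theorem tendsto {U : E3 → ℝ} {a b : ℝ} (h : HasHarmonicExpansion U a b) :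
    Tendsto U (cobounded E3) (𝓝 a) := by
  have h₁ : Tendsto (fun x ↦ U x - (a + b * ‖x‖⁻¹)) (cobounded E3) (𝓝 0) :=
    h.trans_tendsto tendsto_norm_rpow_neg_two_cobounded
  have h₂ : Tendsto (fun x : E3 ↦ a + b * ‖x‖⁻¹) (cobounded E3) (𝓝 a) := by
    simpa using tendsto_const_nhds.add (tendsto_inv_norm_cobounded.const_mul b)
  have := h₁.add h₂
  simpa using this

/-- The expansion only depends on the germ of the function at infinity. [folklore] -/
theorem congr {U V : E3 → ℝ} {a b : ℝ} (h : HasHarmonicExpansion U a b)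
    (hUV : U =ᶠ[cobounded E3] V) : HasHarmonicExpansion V a b :=
  h.congr' (hUV.mono fun x hx ↦ show U x - _ = V x - _ by rw [hx]) EventuallyEq.rfl

/-- **The coefficients `a`, `b` of the expansion are determined by the germ at infinity**
(so that Bray's total mass `2ab`, Def. 2, is well defined for a given conformal factor): if `U`
and `V` agree near infinity and have expansions `(a, b)`, `(a', b')`, then `a = a'` (limits) and
`b = b'` (otherwise `|b - b'|/|x| = O(|x|⁻²)` would bound `|x|`). Bray 2001, §2, Def. 2.
[cite: BrayRPI2001, §2 Def. 2] -/
theorem unique {U V : E3 → ℝ} {a b a' b' : ℝ} (h : HasHarmonicExpansion U a b)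
    (h' : HasHarmonicExpansion V a' b') (hUV : U =ᶠ[cobounded E3] V) : a = a' ∧ b = b' := by
  have ha : a = a' := tendsto_nhds_unique h.tendsto (h'.tendsto.congr' hUV.symm)
  subst ha
  refine ⟨rfl, ?_⟩
  -- the difference of the two expansions
  have hdiff : (fun x : E3 ↦ (b - b') * ‖x‖⁻¹) =O[cobounded E3] fun x ↦ ‖x‖ ^ (-2 : ℝ) := by
    refine ((h'.congr hUV.symm).sub h).congr_left fun x ↦ ?_
    ring
  by_contra hb
  have hb' : 0 < |b - b'| := abs_pos.2 (sub_ne_zero.2 hb)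
  obtain ⟨C, hC₀, hC⟩ := hdiff.exists_pos
  rw [IsBigOWith_def] at hC
  obtain ⟨x, hx₁, hx₂⟩ :=
    (hC.and (eventually_cobounded_le_norm (E := E3) (max 1 (2 * C / |b - b'|)))).exists
  have hx1 : 1 ≤ ‖x‖ := (le_max_left _ _).trans hx₂
  have hx0 : 0 < ‖x‖ := one_pos.trans_le hx1
  have hxC : 2 * C / |b - b'| ≤ ‖x‖ := (le_max_right _ _).trans hx₂
  -- `|b - b'| / |x| ≤ C / |x|²`, i.e. `|b - b'| |x| ≤ C`, contradicting `|x| ≥ 2C/|b - b'|`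
  have hxne : ‖x‖ ≠ 0 := hx0.ne'
  have h1 : |b - b'| * ‖x‖⁻¹ ≤ C * (‖x‖ ^ 2)⁻¹ := by
    have e1 : ‖(b - b') * ‖x‖⁻¹‖ = |b - b'| * ‖x‖⁻¹ := by
      rw [Real.norm_eq_abs, abs_mul, abs_inv, abs_norm]
    have e2 : ‖‖x‖ ^ (-2 : ℝ)‖ = (‖x‖ ^ 2)⁻¹ := by
      rw [Real.norm_of_nonneg (Real.rpow_nonneg (norm_nonneg _) _), Real.rpow_neg (norm_nonneg _),
        Real.rpow_two]
    rw [← e1, ← e2]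
    exact hx₁
  have h2 : |b - b'| * ‖x‖ ≤ C := by
    have h1' := mul_le_mul_of_nonneg_right h1 (pow_nonneg hx0.le 2)
    calc |b - b'| * ‖x‖ = |b - b'| * ‖x‖⁻¹ * ‖x‖ ^ 2 := by field_simp
      _ ≤ C * (‖x‖ ^ 2)⁻¹ * ‖x‖ ^ 2 := h1'
      _ = C := by field_simp
  have h3 : 2 * C ≤ |b - b'| * ‖x‖ := by
    rw [div_le_iff₀ hb'] at hxC
    linarith [mul_comm ‖x‖ |b - b'|]
  linarith

end HasHarmonicExpansion

/-! ### Harmonically flat ends (Def. 1) and their total mass (Def. 2) -/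

namespace AFEnd

variable {X : Type*} [TopologicalSpace X] [ChartedSpace E3 X] [IsManifold (𝓡 3) ∞ X]
  (e : AFEnd X) (D : InitialDataSet (𝓡 3) X)

/-- **The end `e` is harmonically flat beyond radius `R₁` with conformal factor `U`** (Bray,
J. Differential Geom. 59 (2001), §2, Def. 1, for the one end `e` read in its chart: *"a
Riemannian manifold is harmonically flat at infinity if, outside a compact set, it is the
disjoint union of regions (ends) with zero scalar curvature which are conformal to
`(ℝ³ ∖ B₁(0), δ)` with the conformal factor approaching a positive constant at infinity"*, with
(9) `g₀ = 𝒰₀(x)⁴ g_flat` and the sentence following it: *"since `(M³, g₀)` has zero scalar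
curvature in each end … this implies that `𝒰₀(x)` is harmonic in `(ℝ³ ∖ B₁(0), δ)`"* — App. A,
`R(u⁴ g) = u⁻⁵ (-8 Δ_g + R(g)) u`). Clauses: `e.R ≤ R₁`; on `{R₁ < ‖x‖}` the chart metric is
`h_ij(x) = U(x)⁴ δ_ij` (`hCoeff`) with `U(x) > 0`, the scalar curvature vanishes
(`scalarCurvatureCoeff`), and `U` is harmonic for the flat Laplacian
(`InnerProductSpace.HarmonicOnNhd`, the printed consequence of `R = 0`, recorded alongside it);
and `U → a` at infinity for some constant `a > 0` ("positive constant"; `U > 0` fixes the sign of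
the fourth root). Not the notion `AFEnd.HasHarmonicAsymptotics` of `HarmonicAsymptotics.lean`
(Eichmair–Huang–Lee–Schoen, Def. 4: `u → 1`, weighted-Hölder remainder, `u` not harmonic,
momentum clause). [cite: BrayRPI2001, §2 Def. 1 with (9) and App. A] -/
def IsHarmonicallyFlatWith [D.metric.HasLeviCivita] (R₁ : ℝ) (U : E3 → ℝ) : Prop :=
  e.R ≤ R₁ ∧
  (∀ x : E3, R₁ < ‖x‖ →
    0 < U x ∧ hCoeff e D x = (U x) ^ 4 • (innerSL ℝ (E := E3) : E3 →L[ℝ] E3 →L[ℝ] ℝ) ∧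
      e.scalarCurvatureCoeff D x = 0) ∧
  InnerProductSpace.HarmonicOnNhd U {x : E3 | R₁ < ‖x‖} ∧
  ∃ a : ℝ, 0 < a ∧ Tendsto U (cobounded E3) (𝓝 a)

/-- **The end `e` is harmonically flat** (Bray 2001, §2, Def. 1, one end): for some radius and
some conformal factor. [cite: BrayRPI2001, §2 Def. 1] -/
def IsHarmonicallyFlat [D.metric.HasLeviCivita] : Prop :=
  ∃ (R₁ : ℝ) (U : E3 → ℝ), e.IsHarmonicallyFlatWith D R₁ U

/-- **The end `e` is harmonically flat with total mass `m`** (Bray 2001, §2, Def. 2: *"the total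
mass (of an end) of a Riemannian `3`-manifold which is harmonically flat at infinity is defined
to be `2ab`"* in the expansion (10) `𝒰₀(x) = a + b/|x| + O(1/|x|²)` of the conformal factor):
there are a radius `R₁`, a conformal factor `U` with `e.IsHarmonicallyFlatWith D R₁ U`, and
coefficients `a`, `b` with `U = a + b/|x| + O(|x|⁻²)` and `m = 2ab`. The number `m` does not
depend on the choices (`HasHarmonicallyFlatMass.unique`). Bray's remark that `2ab` is also
invariant under rescaling the chart, and agrees with the ADM mass (225), concerns other charts;
in the fixed chart of `e` see `Bray2001_harmonicallyFlatMass_hasADMEnergy`.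
[cite: BrayRPI2001, §2 Def. 2 with (10)] -/
def HasHarmonicallyFlatMass [D.metric.HasLeviCivita] (m : ℝ) : Prop :=
  ∃ (R₁ : ℝ) (U : E3 → ℝ) (a b : ℝ),
    e.IsHarmonicallyFlatWith D R₁ U ∧ HasHarmonicExpansion U a b ∧ m = 2 * a * b

variable {e D} [D.metric.HasLeviCivita] {R₁ : ℝ} {U : E3 → ℝ}

namespace IsHarmonicallyFlatWith

/-- The radius of harmonic flatness is at least the inner radius of the end. [folklore] -/
lemma le_radius (h : e.IsHarmonicallyFlatWith D R₁ U) : e.R ≤ R₁ :=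
  h.1

/-- The conformal factor is positive beyond the radius. [cite: BrayRPI2001, §2 Def. 1] -/
lemma pos (h : e.IsHarmonicallyFlatWith D R₁ U) {x : E3} (hx : R₁ < ‖x‖) : 0 < U x :=
  (h.2.1 x hx).1

/-- Beyond the radius the chart metric is `U⁴ δ`. [cite: BrayRPI2001, §2 (9)] -/
lemma hCoeff_eq (h : e.IsHarmonicallyFlatWith D R₁ U) {x : E3} (hx : R₁ < ‖x‖) :
    hCoeff e D x = (U x) ^ 4 • (innerSL ℝ (E := E3) : E3 →L[ℝ] E3 →L[ℝ] ℝ) :=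
  (h.2.1 x hx).2.1

/-- Beyond the radius the scalar curvature vanishes ("zero scalar curvature").
[cite: BrayRPI2001, §2 Def. 1] -/
lemma scalarCurvatureCoeff_eq_zero (h : e.IsHarmonicallyFlatWith D R₁ U) {x : E3}
    (hx : R₁ < ‖x‖) : e.scalarCurvatureCoeff D x = 0 :=
  (h.2.1 x hx).2.2

/-- The conformal factor is harmonic beyond the radius. [cite: BrayRPI2001, §2 after (9)] -/
lemma harmonicOnNhd (h : e.IsHarmonicallyFlatWith D R₁ U) :
    InnerProductSpace.HarmonicOnNhd U {x : E3 | R₁ < ‖x‖} :=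
  h.2.2.1

/-- The conformal factor tends to a positive constant. [cite: BrayRPI2001, §2 Def. 1] -/
lemma exists_tendsto (h : e.IsHarmonicallyFlatWith D R₁ U) :
    ∃ a : ℝ, 0 < a ∧ Tendsto U (cobounded E3) (𝓝 a) :=
  h.2.2.2

/-- Harmonic flatness beyond `R₁` persists beyond any larger radius. [folklore] -/
lemma mono (h : e.IsHarmonicallyFlatWith D R₁ U) {R₂ : ℝ} (hR : R₁ ≤ R₂) :
    e.IsHarmonicallyFlatWith D R₂ U :=
  ⟨h.1.trans hR, fun x hx ↦ h.2.1 x (hR.trans_lt hx), h.2.2.1.mono fun _ hx ↦ hR.trans_lt hx,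
    h.2.2.2⟩

/-- A harmonically flat end (with data) is harmonically flat. [folklore] -/
lemma isHarmonicallyFlat (h : e.IsHarmonicallyFlatWith D R₁ U) : e.IsHarmonicallyFlat D :=
  ⟨R₁, U, h⟩
/-- **The conformal factor is determined by the metric**: two conformal factors of the same end
agree wherever both apply (`U⁴ δ = V⁴ δ` evaluated on a unit vector, and positivity).
Bray 2001, §2, (9). [cite: BrayRPI2001, §2 (9)] -/
theorem factor_eq {R₂ : ℝ} {V : E3 → ℝ} (hU : e.IsHarmonicallyFlatWith D R₁ U)
    (hV : e.IsHarmonicallyFlatWith D R₂ V) {x : E3} (hx₁ : R₁ < ‖x‖) (hx₂ : R₂ < ‖x‖) :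
    U x = V x := by
  have h4 : (U x) ^ 4 = (V x) ^ 4 := by
    have := (hU.hCoeff_eq hx₁).symm.trans (hV.hCoeff_eq hx₂)
    have hv : (innerSL ℝ (E := E3) : E3 →L[ℝ] E3 →L[ℝ] ℝ) (EuclideanSpace.single 0 1)
        (EuclideanSpace.single 0 1) = 1 := by
      change inner ℝ (EuclideanSpace.single (0 : Fin 3) (1 : ℝ)) (EuclideanSpace.single 0 1) = 1
      simp
    have h1 := congrArg (fun B : E3 →L[ℝ] E3 →L[ℝ] ℝ ↦
      B (EuclideanSpace.single 0 1) (EuclideanSpace.single 0 1)) this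
    simp only [smul_apply, smul_eq_mul, hv, mul_one] at h1
    exact h1
  exact (pow_left_inj₀ (hU.pos hx₁).le (hV.pos hx₂).le (by norm_num)).1 h4

/-- Two conformal factors of the same end agree near infinity. [folklore] -/
theorem factor_eventuallyEq {R₂ : ℝ} {V : E3 → ℝ} (hU : e.IsHarmonicallyFlatWith D R₁ U)
    (hV : e.IsHarmonicallyFlatWith D R₂ V) : U =ᶠ[cobounded E3] V := by
  filter_upwards [eventually_cobounded_le_norm (E := E3) (max R₁ R₂ + 1)] with x hx
  exact hU.factor_eq hV (by linarith [le_max_left R₁ R₂]) (by linarith [le_max_right R₁ R₂])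

end IsHarmonicallyFlatWith

/-- A harmonically flat end with a mass is harmonically flat. [folklore] -/
lemma HasHarmonicallyFlatMass.isHarmonicallyFlat {m : ℝ} (h : e.HasHarmonicallyFlatMass D m) :
    e.IsHarmonicallyFlat D := by
  obtain ⟨R₁, U, -, -, hU, -, -⟩ := h
  exact hU.isHarmonicallyFlat

/-- **Bray's total mass of a harmonically flat end is well defined** (Bray 2001, §2, after
Def. 2: "it can be checked that `2ab` does not [depend on the representation]" — here for the
fixed chart of the end: the conformal factor is determined near infinity,
`IsHarmonicallyFlatWith.factor_eventuallyEq`, and so are its expansion coefficients,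
`HasHarmonicExpansion.unique`). [cite: BrayRPI2001, §2 Def. 2] -/
theorem HasHarmonicallyFlatMass.unique {m m' : ℝ} (h : e.HasHarmonicallyFlatMass D m)
    (h' : e.HasHarmonicallyFlatMass D m') : m = m' := by
  obtain ⟨R₁, U, a, b, hU, hab, rfl⟩ := h
  obtain ⟨R₂, V, a', b', hV, hab', rfl⟩ := h'
  obtain ⟨rfl, rfl⟩ := hab.unique hab' (hU.factor_eventuallyEq hV)
  rfl

end AFEnd

/-! ### Named facts: the expansion (10) and Def. 2 versus (225) -/

/-- **Harmonic functions tending to a constant at infinity have the expansion (10)** (named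
fact). Bray, J. Differential Geom. 59 (2001), §2: *"since `𝒰₀(x)` is a harmonic function going
to a constant at infinity, we may expand it in terms of spherical harmonics to get
`𝒰₀(x) = a + b/|x| + O(1/|x|²)`"*; the underlying theorem is the expansion of a function
harmonic at infinity, Folland, *Introduction to Partial Differential Equations* (2nd ed.),
§2.I, Prop. 2.74 (a function harmonic outside a bounded set of `ℝⁿ`, `n > 2`, tending to `0` is
harmonic at infinity) and the spherical-harmonic expansion in the proof of Prop. 2.75 (the
display `u(x) = ∑ₖ |x|^{2-n-k} Yₖ(x/|x|)` preceding (2.76); for `n = 3`,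
`u = Y₀/|x| + O(|x|⁻²)` with `Y₀` constant), applied to `U - a`. Statement: a function on `E3`
harmonic on `{R₁ < ‖x‖}` and tending to `a` at infinity has the expansion
`a + b/|x| + O(|x|⁻²)` for some `b`. [cite: BrayRPI2001, §2 (10)]
[cite: Folland2020, §2.I Prop. 2.74 and proof of Prop. 2.75 (expansion before (2.76))] -/
def Bray2001_harmonicFactor_expansion : Prop :=
  ∀ (R₁ : ℝ) (U : E3 → ℝ) (a : ℝ),
    InnerProductSpace.HarmonicOnNhd U {x : E3 | R₁ < ‖x‖} → Tendsto U (cobounded E3) (𝓝 a) →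
    ∃ b : ℝ, HasHarmonicExpansion U a b

/-- **Every harmonically flat end has a total mass** (from the named fact
`Bray2001_harmonicFactor_expansion`: the conformal factor is harmonic and tends to a constant,
hence has the expansion (10)). Bray 2001, §2, Def. 2. [cite: BrayRPI2001, §2 Def. 2] -/
theorem AFEnd.IsHarmonicallyFlat.exists_hasHarmonicallyFlatMass
    (hexp : Bray2001_harmonicFactor_expansion) {X : Type*} [TopologicalSpace X]
    [ChartedSpace E3 X] [IsManifold (𝓡 3) ∞ X] {e : AFEnd X} {D : InitialDataSet (𝓡 3) X}
    [D.metric.HasLeviCivita] (h : e.IsHarmonicallyFlat D) : ∃ m : ℝ, e.HasHarmonicallyFlatMass D m := by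
  obtain ⟨R₁, U, hU⟩ := h
  obtain ⟨a, -, ha⟩ := hU.exists_tendsto
  obtain ⟨b, hb⟩ := hexp R₁ U a hU.harmonicOnNhd ha
  exact ⟨2 * a * b, R₁, U, a, b, hU, hb, rfl⟩

/-- **Def. 2 agrees with the ADM mass (225) in the asymptotically flat chart** (named fact).
Bray, J. Differential Geom. 59 (2001), §2, after Def. 2: *"this definition agrees with the
standard definition of the total mass of an asymptotically flat manifold (defined in equation
(225)) in the case that the manifold is harmonically flat at infinity"*; (225) is the flux limit
`(16π)⁻¹ lim_σ ∮_{S_σ} ∑ (g_ij,i - g_ii,j) νⱼ dμ` in a chart with `g_ij → δ_ij`, i.e. `U → 1`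
(`a = 1`) in the fixed chart of `e`: for `h_ij = U⁴ δ_ij` the integrand is
`-2 ∂_r(U⁴) = -8 U³ ∂_r U`, and `U = 1 + b/|x| + O(|x|⁻²)` harmonic (`∂_r U = -b/|x|² + O(|x|⁻³)`,
Folland (2.76)) gives the limit `(16π)⁻¹ · 8b · 4π = 2b = 2ab` (for `a ≠ 1` the same chart would
give `2a³b`; Bray's rescaling `x ↦ a² x`, under which `2ab` is invariant, reduces to `a = 1`).
Statement: if `e` is harmonically flat with total mass `m` and its conformal factor tends to `1`,
the ADM energy fluxes converge to `m` (`e.HasADMEnergy D m`).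
[cite: BrayRPI2001, §2 Def. 2 and §13 (225)] -/
def Bray2001_harmonicallyFlatMass_hasADMEnergy : Prop :=
  ∀ (X : Type) [TopologicalSpace X] [ChartedSpace E3 X] [IsManifold (𝓡 3) ∞ X]
    (D : InitialDataSet (𝓡 3) X) [D.metric.HasLeviCivita] (e : AFEnd X) (m : ℝ),
    e.HasHarmonicallyFlatMass D m →
    (∃ (R₁ : ℝ) (U : E3 → ℝ), e.IsHarmonicallyFlatWith D R₁ U ∧ Tendsto U (cobounded E3) (𝓝 1)) →
    e.HasADMEnergy D m

end Literature.Geometry.Lorentzian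

end
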